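import Summits.Ventures.CertifiedManyBodySolver.Downfold.EmeryFermiEnergyExists
import Summits.Ventures.CertifiedManyBodySolver.Downfold.EmeryHolesAntibondingOnly
import Mathlib.Topology.Semicontinuity.Basic
import Mathlib.MeasureTheory.Measure.OpenPos
import HarnessLib

/-!
# THE ANTIBONDING BAND IS CONTINUOUS, ITS TOP ROOT IS SIMPLE OFF Γ, AND THE FERMI ENERGY IS UNIQUE: sign characterisation of the
# secular cubic at positive energies, strict monotonicity of the filling map, `∃! ε_F` in every certified doping window

Venture CertifiedManyBodySolver, cell `pub/hubbard-downfold` (stage S1; INFLATION-RULES-3to1-B §B.82 (h)–(k)), seat hubbard-downfold-mod-4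
(technique B, g34); namespace `Summit.Ventures.CertifiedManyBodySolver.Downfold.Emery`. Everything PROVED (0 sorry). WHAT THIS IS NOT: a statement
about any material; `U = 0` one-body kinematics of the σ (d–p_x–p_y + t_pp, t_pp′) model; no number lives here.

Sequel of `EmeryAntibondingBandBorel` (upper semicontinuity ⇒ Borel) and `EmeryFermiEnergyExists` (null level sets ⇒ continuity of the
filling ⇒ existence of the Fermi energy). Here the LOWER half, for `Δ, t_pp, t_pp′ ≥ 0` (the hypotheses of `pos_root_eq_abBand`):

* §1 THE TOP ROOT IS SIMPLE OFF Γ. At a root `E` of the secular cubic, `∂_ε charCubic(E)·E = 2E³ + cubA·E² − charCubic(0)`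
  (`dcharCubic_mul_root`) with `cubA = 2Δ + 4t_pp′(x + y) ≥ 0` and `charCubic(x, y, 0) = −4t_pd²[x(Δ + 4t_pp′y) + y(Δ + 4t_pp′x)] − 32t_pd²t_pp·xy ≤ 0`
  (`charCubic_zero_nonpos`) ⇒ **`0 < ∂_ε charCubic(x, y, ε_AB)` whenever `ε_AB(x, y) > 0`** (`dcharCubic_abBand_pos`) — the antibonding
  sheet is a SIMPLE root of the cubic at every `k ≠ Γ` (there `ε_AB > 0`: `abBand_pos_of_sum_pos`), so the Fermi-velocity / scale denominator
  `∂_ε charCubic` of §B.64–§B.80 is positive with no certificate (it was supplied by `pointScale_of_checks` row by row).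
* §2 SIGN CHARACTERISATION AT POSITIVE ENERGIES: for every `t > 0`, **`charCubic(x, y, t) < 0 ⟺ t < ε_AB(x, y)`** and
  **`0 < charCubic(x, y, t) ⟺ ε_AB(x, y) < t`** (`charCubic_neg_iff_lt_abBand`, `charCubic_pos_iff_abBand_lt`; synthetic division at the top
  root, the quadratic cofactor is `> 0` on `t > 0`) — the two one-sided cell tests of `EmeryFermiFillingCount`/`EmeryZoneOrbitalContent` are
  the two halves of one equivalence; no Taylor side condition is needed at positive energies.
* §3 **THE ANTIBONDING BAND IS CONTINUOUS ON THE ZONE** (`continuous_abEnergyK`: upper semicontinuity from `EmeryAntibondingBandBorel`; lower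
  semicontinuity from §2 — below `ε_AB(k₀)` the cubic is negative at a positive test energy, an open condition in `k`; at `Γ` from `ε_AB ≥ 0`).
  Hence the hole region `{ε < ε_AB}` is open and the Fermi surface `{ε_AB = ε}` is closed (and null, `EmeryFermiEnergyExists`).
* §4 **THE FILLING MAP IS STRICTLY INCREASING ON THE BAND** (`abFilling_lt_abFilling`: for `0 ≤ ε₁ < ε₂` with `ε₂` not above the band at
  some zone point, the shell `{ε₁ < ε_AB < ε₂}` contains an open nonempty subset of the open square — intermediate value theorem along the ray
  from Γ + density of the open square in the closed one — hence has positive Lebesgue measure) ⇒ **THE FERMI ENERGY IS UNIQUE**: for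
  `0 < ν < 1` at most one `ε` has `abFilling ε = ν` (`fermiEnergy_unique`; `abFilling` vanishes below the band bottom and equals `1` above the
  top, `abFilling_of_neg`, `abFilling_eq_one_of_forall_le`), and with `EmeryFermiEnergyExists`: **every certified `pointBracketCheck` window
  carries EXACTLY ONE Fermi energy per filling** (`existsUnique_fermiEnergy_of_pointBracketCheck`; `0 < ν₁`, `ν₂ < 1` follow from the check).

Sources: three-band model [HybertsenSchluterChristensen1989, Eq. (1)]; bilinear contour form [AndersenEtAl1995, §6]; semicontinuity,
positivity of Lebesgue measure on open sets, intermediate value theorem [folklore].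
-/

noncomputable section

namespace Summit.Ventures.CertifiedManyBodySolver.Downfold.Emery

open Real MeasureTheory Set Filter Topology
open scoped ENNReal

/-! ## §1 The top root is simple off Γ -/

section Simple

variable {Δ a b c x y : ℝ}

/-- `charCubic(x, y, 0) = −(4t_pd²x(Δ + 4t_pp′y) + 4t_pd²y(Δ + 4t_pp′x) + 32t_pd²t_pp·xy)`. [folklore] -/
theorem charCubic_zero_eq (Δ a b c x y : ℝ) :
    charCubic Δ a b c x y 0 = -(4 * a ^ 2 * x * (Δ + 4 * c * y) + 4 * a ^ 2 * y * (Δ + 4 * c * x) + 32 * a ^ 2 * b * x * y) := by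
  unfold charCubic; ring

/-- `charCubic(x, y, 0) ≤ 0` for `Δ, t_pp, t_pp′, x, y ≥ 0`. [folklore] -/
theorem charCubic_zero_nonpos (hΔ : 0 ≤ Δ) (hc : 0 ≤ c) (hb : 0 ≤ b) (hx : 0 ≤ x) (hy : 0 ≤ y) : charCubic Δ a b c x y 0 ≤ 0 := by
  rw [charCubic_zero_eq]
  have : 0 ≤ 4 * a ^ 2 * x * (Δ + 4 * c * y) + 4 * a ^ 2 * y * (Δ + 4 * c * x) + 32 * a ^ 2 * b * x * y := by positivity
  linarith

/-- `charCubic(x, y, 0) < 0` off Γ (`Δ > 0`, `t_pd ≠ 0`, `x + y > 0`). [folklore] -/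
theorem charCubic_zero_neg (hΔ : 0 < Δ) (ha : a ≠ 0) (hc : 0 ≤ c) (hb : 0 ≤ b) (hx : 0 ≤ x) (hy : 0 ≤ y) (hxy : 0 < x + y) :
    charCubic Δ a b c x y 0 < 0 := by
  rw [charCubic_zero_eq]
  have ha2 : 0 < a ^ 2 := by positivity
  have h1 : 0 ≤ 4 * a ^ 2 * x * (4 * c * y) + 4 * a ^ 2 * y * (4 * c * x) + 32 * a ^ 2 * b * x * y := by positivity
  have h2 : 0 < 4 * a ^ 2 * Δ * (x + y) := by positivity
  nlinarith

/-- AT A ROOT `E` of the secular cubic: `∂_ε charCubic(E)·E = 2E³ + cubA·E² − charCubic(0)`. [folklore] -/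
theorem dcharCubic_mul_root {E : ℝ} (hE : charCubic Δ a b c x y E = 0) :
    dcharCubic Δ a b c x y E * E = 2 * E ^ 3 + cubA Δ c x y * E ^ 2 - charCubic Δ a b c x y 0 := by
  have h1 := charCubic_eq_monicCubic Δ a b c x y E
  have h0 := charCubic_eq_monicCubic Δ a b c x y 0
  rw [hE] at h1
  rw [dcharCubic_eq_deriv, h0]
  unfold monicCubic at h1 ⊢
  nlinarith [h1]

/-- **THE TOP ROOT IS SIMPLE OFF Γ: `0 < ∂_ε charCubic(x, y, ε_AB(x, y))` whenever `ε_AB > 0`** (`Δ, t_pp, t_pp′, x, y ≥ 0`). [folklore] -/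
theorem dcharCubic_abBand_pos (hΔ : 0 ≤ Δ) (hc : 0 ≤ c) (hb : 0 ≤ b) (hx : 0 ≤ x) (hy : 0 ≤ y) (hE : 0 < abBand Δ a b c x y) :
    0 < dcharCubic Δ a b c x y (abBand Δ a b c x y) := by
  set E := abBand Δ a b c x y with hEdef
  have hid := dcharCubic_mul_root (charCubic_abBand Δ a b c x y)
  have hA : 0 ≤ cubA Δ c x y := by unfold cubA; positivity
  have hp0 := charCubic_zero_nonpos (a := a) hΔ hc hb hx hy
  have hpos : 0 < dcharCubic Δ a b c x y E * E := by
    rw [hid]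
    have : 0 < 2 * E ^ 3 := by positivity
    have : 0 ≤ cubA Δ c x y * E ^ 2 := by positivity
    linarith
  by_contra hle
  push Not at hle
  nlinarith

/-- **THE ANTIBONDING BAND IS POSITIVE OFF Γ** (`Δ > 0`, `t_pd ≠ 0`, `x + y > 0`). [folklore] -/
theorem abBand_pos_of_sum_pos (hΔ : 0 < Δ) (ha : a ≠ 0) (hc : 0 ≤ c) (hb : 0 ≤ b) (hx : 0 ≤ x) (hy : 0 ≤ y) (hxy : 0 < x + y) :
    0 < abBand Δ a b c x y := by
  have h0 := abBand_nonneg (tpd := a) hΔ.le hc hb hx hy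
  rcases h0.lt_or_eq with h | h
  · exact h
  · exfalso
    have hroot := charCubic_abBand Δ a b c x y
    rw [← h] at hroot
    have := charCubic_zero_neg hΔ ha hc hb hx hy hxy
    linarith

end Simple

/-! ## §2 Sign characterisation of the secular cubic at positive energies -/

section Sign

variable {Δ a b c x y : ℝ}

/-- Below the antibonding band, at a positive energy, the cubic is NEGATIVE. [folklore] -/
theorem charCubic_neg_of_pos_of_lt_abBand (hΔ : 0 ≤ Δ) (hc : 0 ≤ c) (hb : 0 ≤ b) (hx : 0 ≤ x) (hy : 0 ≤ y) {t : ℝ} (ht : 0 < t)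
    (htE : t < abBand Δ a b c x y) : charCubic Δ a b c x y t < 0 := by
  set E := abBand Δ a b c x y with hEdef
  have hE : 0 < E := ht.trans htE
  have hfac := charCubic_factor_root (charCubic_abBand Δ a b c x y) t
  have hfac0 := charCubic_factor_root (charCubic_abBand Δ a b c x y) 0
  have hp0 := charCubic_zero_nonpos (a := a) hΔ hc hb hx hy
  have hA : 0 ≤ cubA Δ c x y := by unfold cubA; positivity
  have hQ0 : 0 ≤ E ^ 2 + cubA Δ c x y * E + cubB Δ a b c x y := by
    by_contra hneg
    push Not at hneg
    have : 0 < charCubic Δ a b c x y 0 := by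
      rw [hfac0]
      have e1 : (0 : ℝ) - E < 0 := by linarith
      have e2 : (0 : ℝ) ^ 2 + (E + cubA Δ c x y) * 0 + (E ^ 2 + cubA Δ c x y * E + cubB Δ a b c x y) < 0 := by linarith
      exact mul_pos_of_neg_of_neg e1 e2
    linarith
  rw [hfac]
  apply mul_neg_of_neg_of_pos (by linarith)
  nlinarith [sq_nonneg t]

/-- Above the antibonding band the cubic is POSITIVE (any energy). [folklore] -/
theorem charCubic_pos_of_abBand_lt {t : ℝ} (h : abBand Δ a b c x y < t) : 0 < charCubic Δ a b c x y t := by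
  rw [charCubic_eq_monicCubic]
  exact monicCubic_pos_of_topRoot_lt (by unfold abBand at h; exact h)

/-- A strictly negative value of the cubic lies strictly below the antibonding band. [folklore] -/
theorem lt_abBand_of_charCubic_neg {t : ℝ} (h : charCubic Δ a b c x y t < 0) : t < abBand Δ a b c x y := by
  rcases (le_abBand_of_charCubic_nonpos h.le).lt_or_eq with hlt | heq
  · exact hlt
  · exfalso
    have := charCubic_abBand Δ a b c x y
    rw [← heq] at this
    linarith

/-- **`charCubic(t) < 0 ⟺ t < ε_AB`** for `t > 0` (`Δ, t_pp, t_pp′, x, y ≥ 0`). [folklore] -/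
theorem charCubic_neg_iff_lt_abBand (hΔ : 0 ≤ Δ) (hc : 0 ≤ c) (hb : 0 ≤ b) (hx : 0 ≤ x) (hy : 0 ≤ y) {t : ℝ} (ht : 0 < t) :
    charCubic Δ a b c x y t < 0 ↔ t < abBand Δ a b c x y :=
  ⟨lt_abBand_of_charCubic_neg, charCubic_neg_of_pos_of_lt_abBand hΔ hc hb hx hy ht⟩

/-- **`0 < charCubic(t) ⟺ ε_AB < t`** for `t > 0` (`Δ, t_pp, t_pp′, x, y ≥ 0`). [folklore] -/
theorem charCubic_pos_iff_abBand_lt (hΔ : 0 ≤ Δ) (hc : 0 ≤ c) (hb : 0 ≤ b) (hx : 0 ≤ x) (hy : 0 ≤ y) {t : ℝ} (ht : 0 < t) :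
    0 < charCubic Δ a b c x y t ↔ abBand Δ a b c x y < t := by
  refine ⟨fun hp => ?_, charCubic_pos_of_abBand_lt⟩
  by_contra hle
  push Not at hle
  rcases hle.lt_or_eq with hlt | heq
  · have := charCubic_neg_of_pos_of_lt_abBand hΔ hc hb hx hy ht hlt; linarith
  · have := charCubic_abBand Δ a b c x y; rw [← heq] at this; linarith

end Sign

/-! ## §3 The antibonding band is continuous on the zone -/

section Continuity

variable {Δ a b c : ℝ}

/-- `ε_AB(k) ≥ 0` everywhere (`Δ, t_pp, t_pp′ ≥ 0`). [folklore] -/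
theorem abEnergyK_nonneg (hΔ : 0 ≤ Δ) (hc : 0 ≤ c) (hb : 0 ≤ b) (k : ℝ × ℝ) : 0 ≤ abEnergyK Δ a b c k :=
  abBand_nonneg hΔ hc hb (halfSq_nonneg _) (halfSq_nonneg _)

/-- `k ↦ charCubic(sin²(k_x/2), sin²(k_y/2), t)` is continuous. [folklore] -/
theorem continuous_charCubicK (Δ a b c t : ℝ) : Continuous fun k : ℝ × ℝ => charCubic Δ a b c (halfSq k.1) (halfSq k.2) t := by
  have h1 : Continuous fun k : ℝ × ℝ => halfSq k.1 := continuous_halfSq.comp continuous_fst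
  have h2 : Continuous fun k : ℝ × ℝ => halfSq k.2 := continuous_halfSq.comp continuous_snd
  unfold charCubic; fun_prop

/-- **THE ANTIBONDING BAND IS LOWER SEMICONTINUOUS ON THE ZONE** (`Δ, t_pp, t_pp′ ≥ 0`). [folklore] -/
theorem lowerSemicontinuous_abEnergyK (hΔ : 0 ≤ Δ) (hc : 0 ≤ c) (hb : 0 ≤ b) : LowerSemicontinuous (abEnergyK Δ a b c) := by
  refine lowerSemicontinuous_iff.mpr fun k₀ => lowerSemicontinuousAt_iff.mpr fun μ hμ => ?_
  by_cases hμ0 : μ < 0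
  · exact Filter.Eventually.of_forall fun k => lt_of_lt_of_le hμ0 (abEnergyK_nonneg hΔ hc hb k)
  push Not at hμ0
  set t : ℝ := (μ + abEnergyK Δ a b c k₀) / 2 with ht
  have ht0 : 0 < t := by rw [ht]; linarith
  have htμ : μ < t := by rw [ht]; linarith
  have htE : t < abEnergyK Δ a b c k₀ := by rw [ht]; linarith
  have hneg : charCubic Δ a b c (halfSq k₀.1) (halfSq k₀.2) t < 0 :=
    charCubic_neg_of_pos_of_lt_abBand hΔ hc hb (halfSq_nonneg _) (halfSq_nonneg _) ht0 htE
  have hev : ∀ᶠ k in 𝓝 k₀, charCubic Δ a b c (halfSq k.1) (halfSq k.2) t < 0 :=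
    ((continuous_charCubicK Δ a b c t).continuousAt (x := k₀)).eventually_lt continuousAt_const hneg
  exact hev.mono fun k hk => lt_trans htμ (lt_abBand_of_charCubic_neg hk)

/-- **THE ANTIBONDING BAND IS CONTINUOUS ON THE ZONE** (`Δ, t_pp, t_pp′ ≥ 0`; every `t_pd`). [folklore] -/
theorem continuous_abEnergyK (hΔ : 0 ≤ Δ) (hc : 0 ≤ c) (hb : 0 ≤ b) : Continuous (abEnergyK Δ a b c) :=
  continuous_iff_lower_upperSemicontinuous.mpr ⟨lowerSemicontinuous_abEnergyK hΔ hc hb, upperSemicontinuous_abEnergyK Δ a b c⟩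

/-- The hole region `{ε < ε_AB}` is open. [folklore] -/
theorem isOpen_holeSet (hΔ : 0 ≤ Δ) (hc : 0 ≤ c) (hb : 0 ≤ b) (ε : ℝ) : IsOpen {k : ℝ × ℝ | ε < abEnergyK Δ a b c k} :=
  isOpen_lt continuous_const (continuous_abEnergyK hΔ hc hb)

/-- The Fermi surface `{ε_AB = ε}` is closed. [folklore] -/
theorem isClosed_levelSet (hΔ : 0 ≤ Δ) (hc : 0 ≤ c) (hb : 0 ≤ b) (ε : ℝ) : IsClosed {k : ℝ × ℝ | abEnergyK Δ a b c k = ε} :=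
  isClosed_eq (continuous_abEnergyK hΔ hc hb) continuous_const

/-- `ε_AB(Γ) = 0`. [folklore] -/
theorem abEnergyK_zero (hΔ : 0 ≤ Δ) (a b c : ℝ) : abEnergyK Δ a b c (0, 0) = 0 := by
  unfold abEnergyK halfSq
  simp only [zero_div, Real.sin_zero]
  norm_num
  exact abBand_Gamma hΔ a b c

end Continuity

/-! ## §4 The filling map is strictly increasing on the band; the Fermi energy is unique -/

section Unique

variable {Δ a b c : ℝ}

/-- **AN ENERGY SHELL INSIDE THE BAND HAS POSITIVE MEASURE**: for `0 ≤ ε₁ < ε₂` with `ε₂ ≤ ε_AB(k⋆)` at some zone point `k⋆`, the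
open shell `{ε₁ < ε_AB < ε₂}` meets the open square, hence `volume > 0`. [folklore] -/
theorem volume_shell_pos (hΔ : 0 ≤ Δ) (hc : 0 ≤ c) (hb : 0 ≤ b) {ε₁ ε₂ : ℝ} (h0 : 0 ≤ ε₁) (h12 : ε₁ < ε₂)
    {ks : ℝ × ℝ} (hks : ks ∈ bzQuad) (hk2 : ε₂ ≤ abEnergyK Δ a b c ks) :
    0 < volume (bzQuad ∩ {k | ε₁ < abEnergyK Δ a b c k ∧ abEnergyK Δ a b c k < ε₂}) := by
  have hcont := continuous_abEnergyK (a := a) hΔ hc hb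
  set mid : ℝ := (ε₁ + ε₂) / 2 with hmid
  have hm1 : ε₁ < mid := by rw [hmid]; linarith
  have hm2 : mid < ε₂ := by rw [hmid]; linarith
  have hpath : Continuous fun s : ℝ => abEnergyK Δ a b c (s * ks.1, s * ks.2) := by fun_prop
  have hg0 : abEnergyK Δ a b c ((0 : ℝ) * ks.1, (0 : ℝ) * ks.2) = 0 := by simpa using abEnergyK_zero hΔ a b c
  have hg1 : abEnergyK Δ a b c ((1 : ℝ) * ks.1, (1 : ℝ) * ks.2) = abEnergyK Δ a b c ks := by simp
  obtain ⟨s, hs, hsE⟩ := intermediate_value_Icc (zero_le_one : (0 : ℝ) ≤ 1) hpath.continuousOn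
    (show mid ∈ Icc (abEnergyK Δ a b c ((0 : ℝ) * ks.1, (0 : ℝ) * ks.2)) (abEnergyK Δ a b c ((1 : ℝ) * ks.1, (1 : ℝ) * ks.2)) from
      ⟨by rw [hg0]; linarith, by rw [hg1]; linarith⟩)
  set k' : ℝ × ℝ := (s * ks.1, s * ks.2) with hk'
  obtain ⟨⟨hx0, hxπ⟩, ⟨hy0, hyπ⟩⟩ := hks
  have hk'Q : k' ∈ bzQuad := by
    refine ⟨⟨by positivity [hs.1], ?_⟩, ⟨by positivity [hs.1], ?_⟩⟩
    · calc s * ks.1 ≤ 1 * ks.1 := mul_le_mul_of_nonneg_right hs.2 hx0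
        _ ≤ π := by linarith
    · calc s * ks.2 ≤ 1 * ks.2 := mul_le_mul_of_nonneg_right hs.2 hy0
        _ ≤ π := by linarith
  set V : Set (ℝ × ℝ) := {k | ε₁ < abEnergyK Δ a b c k ∧ abEnergyK Δ a b c k < ε₂} ∩ (Ioo 0 π ×ˢ Ioo 0 π) with hV
  have hVopen : IsOpen V := by
    refine IsOpen.inter ?_ (isOpen_Ioo.prod isOpen_Ioo)
    exact (isOpen_lt continuous_const hcont).inter (isOpen_lt hcont continuous_const)
  have hsE' : abEnergyK Δ a b c k' = mid := by simpa [hk'] using hsE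
  have hshell : {k : ℝ × ℝ | ε₁ < abEnergyK Δ a b c k ∧ abEnergyK Δ a b c k < ε₂} ∈ 𝓝 k' :=
    ((isOpen_lt continuous_const hcont).inter (isOpen_lt hcont continuous_const)).mem_nhds
      ⟨show ε₁ < abEnergyK Δ a b c k' by rw [hsE']; exact hm1, show abEnergyK Δ a b c k' < ε₂ by rw [hsE']; exact hm2⟩
  have hclos : k' ∈ closure (Ioo 0 π ×ˢ Ioo 0 π) := by
    rw [closure_prod_eq, closure_Ioo pi_pos.ne, ← show bzQuad = Icc 0 π ×ˢ Icc 0 π from rfl]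
    exact hk'Q
  obtain ⟨k'', hk''⟩ := mem_closure_iff_nhds.mp hclos _ hshell
  have hVne : V.Nonempty := ⟨k'', hk''⟩
  have hVpos : 0 < volume V := hVopen.measure_pos volume hVne
  refine lt_of_lt_of_le hVpos (measure_mono ?_)
  rintro k ⟨hk, ⟨h1, h2⟩, ⟨h3, h4⟩⟩
  exact ⟨⟨⟨h1.le, h2.le⟩, ⟨h3.le, h4.le⟩⟩, hk⟩

/-- **THE FILLING MAP IS STRICTLY INCREASING ON THE BAND**: `0 ≤ ε₁ < ε₂` and `ε₂ ≤ ε_AB(k⋆)` somewhere in the zone ⇒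
`abFilling ε₁ < abFilling ε₂`. [folklore] -/
theorem abFilling_lt_abFilling (hΔ : 0 ≤ Δ) (hc : 0 ≤ c) (hb : 0 ≤ b) {ε₁ ε₂ : ℝ} (h0 : 0 ≤ ε₁) (h12 : ε₁ < ε₂)
    {ks : ℝ × ℝ} (hks : ks ∈ bzQuad) (hk2 : ε₂ ≤ abEnergyK Δ a b c ks) :
    abFilling Δ a b c ε₁ < abFilling Δ a b c ε₂ := by
  have hshell := volume_shell_pos (a := a) hΔ hc hb h0 h12 hks hk2
  set A := bzQuad ∩ {k | abEnergyK Δ a b c k ≤ ε₁} with hA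
  set S := bzQuad ∩ {k | ε₁ < abEnergyK Δ a b c k ∧ abEnergyK Δ a b c k < ε₂} with hS
  set B := bzQuad ∩ {k | abEnergyK Δ a b c k ≤ ε₂} with hB
  have hmE := measurable_abEnergyK Δ a b c
  have hSm : MeasurableSet S :=
    measurableSet_bzQuad.inter ((measurableSet_lt measurable_const hmE).inter (measurableSet_lt hmE measurable_const))
  have hdisj : Disjoint A S := by
    rw [Set.disjoint_left]
    rintro k ⟨-, hkA⟩ ⟨-, hkS, -⟩
    exact absurd (lt_of_lt_of_le hkS hkA) (lt_irrefl _)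
  have hsub : A ∪ S ⊆ B := by
    rintro k (⟨hk, hle⟩ | ⟨hk, -, hlt⟩)
    · exact ⟨hk, le_trans (show abEnergyK Δ a b c k ≤ ε₁ from hle) h12.le⟩
    · exact ⟨hk, le_of_lt hlt⟩
  have hBfin : volume B ≠ ⊤ := ne_top_of_le_ne_top volume_bzQuad_ne_top (measure_mono inter_subset_left)
  have hlt : volume A < volume B := by
    calc volume A < volume A + volume S := ENNReal.lt_add_right
            (ne_top_of_le_ne_top volume_bzQuad_ne_top (measure_mono inter_subset_left)) hshell.ne'
      _ = volume (A ∪ S) := (measure_union hdisj hSm).symm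
      _ ≤ volume B := measure_mono hsub
  unfold abFilling
  rw [abOccSet_eq, abOccSet_eq]
  have hπ : (0 : ℝ) < π ^ 2 := by positivity
  exact div_lt_div_of_pos_right ((ENNReal.toReal_lt_toReal
    (ne_top_of_le_ne_top volume_bzQuad_ne_top (measure_mono inter_subset_left)) hBfin).mpr hlt) hπ

/-- Below the band bottom nothing is occupied: `abFilling ε = 0` for `ε < 0`. [folklore] -/
theorem abFilling_of_neg (hΔ : 0 ≤ Δ) (hc : 0 ≤ c) (hb : 0 ≤ b) {ε : ℝ} (hε : ε < 0) : abFilling Δ a b c ε = 0 := by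
  have hempty : abOccSet Δ a b c ε = ∅ := by
    rw [abOccSet_eq, Set.eq_empty_iff_forall_notMem]
    rintro k ⟨-, hk⟩
    exact absurd (lt_of_le_of_lt (show abEnergyK Δ a b c k ≤ ε from hk) hε) (not_lt.mpr (abEnergyK_nonneg hΔ hc hb k))
  unfold abFilling
  rw [hempty, measure_empty, ENNReal.toReal_zero, zero_div]

/-- `abFilling ≤ 1`. [folklore] -/
theorem abFilling_le_one (Δ a b c ε : ℝ) : abFilling Δ a b c ε ≤ 1 := by
  unfold abFilling
  have hπ : (0 : ℝ) < π ^ 2 := by positivity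
  rw [div_le_one hπ, ← volume_bzQuad_toReal]
  exact ENNReal.toReal_mono volume_bzQuad_ne_top (by rw [abOccSet_eq]; exact measure_mono inter_subset_left)

/-- If the whole zone is occupied the filling is `1`. [folklore] -/
theorem abFilling_eq_one_of_forall_le {ε : ℝ} (h : ∀ k ∈ bzQuad, abEnergyK Δ a b c k ≤ ε) : abFilling Δ a b c ε = 1 := by
  have hset : abOccSet Δ a b c ε = bzQuad := by
    rw [abOccSet_eq]; exact Set.inter_eq_left.mpr fun k hk => h k hk
  unfold abFilling
  rw [hset, volume_bzQuad_toReal]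
  have hπ : (0 : ℝ) < π ^ 2 := by positivity
  field_simp

/-- A filling `< 1` leaves an empty state: some zone point lies strictly above `ε`. [folklore] -/
theorem exists_gt_of_abFilling_lt_one {ε : ℝ} (h : abFilling Δ a b c ε < 1) : ∃ k ∈ bzQuad, ε < abEnergyK Δ a b c k := by
  by_contra hno
  push Not at hno
  have := abFilling_eq_one_of_forall_le (Δ := Δ) (a := a) (b := b) (c := c) hno
  linarith

/-- **THE FERMI ENERGY IS UNIQUE**: for `0 < ν < 1` at most one energy has filling `ν` (`Δ, t_pp, t_pp′ ≥ 0`). [folklore] -/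
theorem fermiEnergy_unique (hΔ : 0 ≤ Δ) (hc : 0 ≤ c) (hb : 0 ≤ b) {ν ε ε' : ℝ} (hν0 : 0 < ν) (hν1 : ν < 1)
    (h : abFilling Δ a b c ε = ν) (h' : abFilling Δ a b c ε' = ν) : ε = ε' := by
  have hε0 : 0 ≤ ε := by
    by_contra hlt; push Not at hlt
    have := abFilling_of_neg (a := a) hΔ hc hb hlt; linarith
  have hε0' : 0 ≤ ε' := by
    by_contra hlt; push Not at hlt
    have := abFilling_of_neg (a := a) hΔ hc hb hlt; linarith
  by_contra hne
  rcases lt_or_gt_of_ne hne with hlt | hlt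
  · obtain ⟨k, hk, hkE⟩ := exists_gt_of_abFilling_lt_one (Δ := Δ) (a := a) (b := b) (c := c) (ε := ε') (by linarith)
    have := abFilling_lt_abFilling hΔ hc hb hε0 hlt hk hkE.le
    linarith
  · obtain ⟨k, hk, hkE⟩ := exists_gt_of_abFilling_lt_one (Δ := Δ) (a := a) (b := b) (c := c) (ε := ε) (by linarith)
    have := abFilling_lt_abFilling hΔ hc hb hε0' hlt hk hkE.le
    linarith

/-- **EVERY CERTIFIED DOPING WINDOW CARRIES EXACTLY ONE FERMI ENERGY PER FILLING**: a passing `pointBracketCheck` with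
`t_pd, t_pp > 0`, `t_pp′ ≤ t_pp` ⇒ for every `ν ∈ [ν₁, ν₂]` there is a UNIQUE `ε` with `abFilling ε = ν`, and it lies in `[e₁, e₂]`
(`0 < ν₁` and `ν₂ < 1` follow from the two certified counts). [folklore] -/
theorem existsUnique_fermiEnergy_of_pointBracketCheck {Δ a b c e₁ e₂ ν₁ ν₂ : ℚ} {jout jin : List ℕ}
    (h : pointBracketCheck Δ a b c e₁ e₂ ν₁ ν₂ jout jin = true) (ha : 0 < a) (hb : 0 < b) (hcb : c ≤ b)
    {ν : ℝ} (hν : ν ∈ Icc (ν₁ : ℝ) ν₂) :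
    (∃! ε : ℝ, abFilling Δ a b c ε = ν) ∧ ∀ ε : ℝ, abFilling Δ a b c ε = ν → ε ∈ Icc (e₁ : ℝ) e₂ := by
  obtain ⟨ε, hε, hfε⟩ := exists_fermiEnergy_of_pointBracketCheck h ha hb hcb hν
  simp only [pointBracketCheck, Bool.and_eq_true, decide_eq_true_eq] at h
  obtain ⟨⟨⟨⟨⟨⟨⟨⟨⟨⟨⟨⟨⟨he₁, he⟩, hΔ⟩, -⟩, hb0⟩, hc⟩, hD₁⟩, hN₁⟩, hD₂⟩, hN₂⟩, hout⟩, hso⟩, hin⟩, hsi⟩ := h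
  have hK : 0 < 384 := by norm_num
  have hso' : (0 : ℝ) < (ν₁ : ℝ) := by
    have h1 : (0 : ℚ) ≤ ((rowSum 384 (fun i => jout.getD i 0) : ℕ) : ℚ) := Nat.cast_nonneg _
    have : (0 : ℚ) < ν₁ * 384 ^ 2 := lt_of_le_of_lt h1 hso
    have : (0 : ℚ) < ν₁ := by nlinarith
    exact_mod_cast this
  have hInR : ((rowSum 384 (fun i => jin.getD i 0) : ℕ) : ℝ) / ((384 : ℕ) : ℝ) ^ 2 ≤
      abFilling (Δ : ℝ) a b c (e₂ : ℝ) := by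
    refine rowSum_inner_le_abFilling hK gridEncl384 hin ?_ ?_ ?_ hD₂ hN₂ le_rfl hΔ (by exact_mod_cast hc) ?_ ?_
      (he₁.trans he)
    · rw [cast_cAQ]
    · rw [cast_fsDQ]
    · rw [cast_fsNQ]
    · push_cast; exact le_rfl
    · push_cast; exact le_rfl
  have hsi' : (ν₂ : ℝ) < ((rowSum 384 (fun i => jin.getD i 0) : ℕ) : ℝ) / ((384 : ℕ) : ℝ) ^ 2 := by
    rw [lt_div_iff₀ (by positivity)]
    have := (Rat.cast_lt (K := ℝ)).2 hsi
    push_cast at this ⊢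
    exact this
  have hν1 : ν < 1 := by
    have := abFilling_le_one (Δ : ℝ) a b c (e₂ : ℝ)
    linarith [hν.2]
  have hν0 : 0 < ν := lt_of_lt_of_le hso' hν.1
  have huniq : ∀ ε' : ℝ, abFilling Δ a b c ε' = ν → ε' = ε := fun ε' h' =>
    fermiEnergy_unique (by exact_mod_cast hΔ) (by exact_mod_cast hc) (by exact_mod_cast hb0) hν0 hν1 h' hfε
  refine ⟨⟨ε, hfε, huniq⟩, fun ε' h' => ?_⟩
  rw [huniq ε' h']; exact hε

end Unique

end Summit.Ventures.CertifiedManyBodySolver.Downfold.Emery
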